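import Mathlib.Geometry.Manifold.MFDeriv.SpecificFunctions
import Mathlib.Geometry.Manifold.MFDeriv.FDeriv
import Mathlib.LinearAlgebra.FiniteDimensional.Basic
import HarnessLib

/-!
# The vertical multiplier of a fibre-preserving self-map along an equivariant immersed fibre

[Milnor2006, §8 (the multiplier `λ` of a fixed point is a conjugacy invariant; Thm. 8.2, Koenigs linearisation)]
[MumfordAV1970, §4 (iv) (`d[n]_e = n`: the differential of multiplication by `n` at the origin is `n`)].

THE FACT.  Let `M` be a manifold, `χ : M ⇀ B × W` a local chart of `M` with values in a product (`B` a manifold — or a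
normed space `P`, §3 — and `W` a finite-dimensional normed space, the "fibre coordinate"), `two : M → M` a self-map and
`π : W → M` a map with `π 0 ∈ χ.source`, `χ (π 0) = (u, 0)`, whose `B`-coordinate `(χ (π z)).1` is constant `= u` near
`z = 0` (i.e. `π` runs inside one fibre of the first coordinate), which is differentiable at `0` with INJECTIVE
differential, and which is EQUIVARIANT: `two (π z) = π (c • z)` near `0`, for a scalar `c`.  Then the fibre coordinate
of `two` in the chart, `G_u : w ↦ (χ (two (χ.symm (u, w)))).2`, fixes `0` and has derivative EXACTLY `c • id` there:
`fderiv 𝕜 G_u 0 = c • ContinuousLinearMap.id 𝕜 W` (`fderiv_snd_conj_eq_smul`, `SelfModel.fderiv_snd_conj_eq_smul`).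
In words: the multiplier of a fibrewise fixed point is read off any equivariant immersed parametrisation of the fibre
— the several-variable, with-parameters form of "the multiplier is a conjugacy invariant" (Milnor), and, for the
doubling map `[2]` of a family of complex tori ∕ abelian varieties parametrised by `z ↦ exp (z)`, of Mumford's
`d[n]_e = n`.

PROOF (derivatives at one point only; no inverse function theorem, no power series).  Put `q z := (χ (π z)).2`.
Near `0`, `χ (π z) = (u, q z)`, so `G_u ∘ q = q ∘ (c • ·)` as germs at `0`.  The differential of `χ ∘ π` at `0` is
`v ↦ (0, Dq v)` (the first coordinate is locally constant) and is injective (`χ.symm ∘ (χ ∘ π) = π` near `0` and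
`Dπ (0)` is injective), so `Dq := fderiv q 0 : W → W` is injective, hence ONTO (`W` finite-dimensional).  The chain
rule on the germ identity gives `DG_u (0) ∘ Dq = Dq ∘ (c • id) = c • Dq`, whence `DG_u (0) = c • id` on `range Dq = W`
(§0 `fderiv_eq_smul_of_conj`, pure calculus).

USE (floor-0 programme P6, crux `HLiu418`, road B of the relative exponential, organ B2 «LINCHART»): with `χ` a
tubular chart of the analytic total space `MA` adapted to `basePoint : MA → MS` and to the zero section, `two` the
analytified doubling map and `π = π_u` the uniformisation of the fibre over `u` (`two ∘ π_u = π_u ∘ (2 •)`), the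
conclusion is LITERALLY the hypothesis `hGd : fderiv ℂ (fun w ↦ G (b, w)) 0 = c • ContinuousLinearMap.id ℂ W` of the
tree's Poincaré–Koenigs linearisation with parameters (★ `Literature.Analysis.Complex.KoenigsLinearization`,
`exists_linearizing_openPartialHomeomorph`) for the coordinate expression `G (b, w) = (χ (two (χ.symm (ψ⁻¹ b, w)))).2`
of `two` in ANY chart `ψ` of the base — so the vertical multiplier of `[2]` along the zero section is the scalar `2`
(no resonances).  §1–§2 read the chart's target `B × W` with the product model `IB.prod 𝓘(𝕜, W)` (`B` any charted
space); §3 (`SelfModel`) reads a normed target `P × W` with the self model `𝓘(𝕜, P × W)`.  THEOREMS ONLY (no `def`,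
no instance, no notation); Mathlib-only imports; any nontrivially normed field `𝕜`, any models.

## References
* [Milnor2006] J. Milnor, *Dynamics in One Complex Variable*, 3rd ed., Ann. of Math. Stud. 160 (2006), §8, Thm. 8.2.
* [MumfordAV1970] D. Mumford, *Abelian Varieties* (1970), §4 (iv).
-/

open Filter Topology Set Function
open scoped Manifold Topology

namespace Literature.Geometry.Manifold.ConjugacyVerticalMultiplier

variable {𝕜 : Type*} [NontriviallyNormedField 𝕜]
  {EM : Type*} [NormedAddCommGroup EM] [NormedSpace 𝕜 EM] {HM : Type*} [TopologicalSpace HM]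
  {I : ModelWithCorners 𝕜 EM HM} {M : Type*} [TopologicalSpace M] [ChartedSpace HM M]
  {EB : Type*} [NormedAddCommGroup EB] [NormedSpace 𝕜 EB] {HB : Type*} [TopologicalSpace HB]
  {IB : ModelWithCorners 𝕜 EB HB} {B : Type*} [TopologicalSpace B] [ChartedSpace HB B]
  {W : Type*} [NormedAddCommGroup W] [NormedSpace 𝕜 W]

/-! ## §0 Calculus: a germ conjugating `q` to `c •` through an onto `Dq (0)` has derivative `c • id` -/

/-- **The multiplier is a conjugacy invariant** (normed-space core).  If `G (q z) = q (c • z)` near `z = 0`, `q 0 = 0`,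
`q` and `G` are differentiable at `0` and `fderiv q 0` is ONTO, then `fderiv G 0 = c • id`.
[cite: Milnor2006, §8 Thm. 8.2] -/
theorem fderiv_eq_smul_of_conj {q G : W → W} {c : 𝕜} (hq0 : q 0 = 0) (hqd : DifferentiableAt 𝕜 q 0)
    (hGd : DifferentiableAt 𝕜 G 0) (hsurj : Surjective (fderiv 𝕜 q 0))
    (hconj : (fun z => G (q z)) =ᶠ[𝓝 0] fun z => q (c • z)) :
    fderiv 𝕜 G 0 = c • ContinuousLinearMap.id 𝕜 W := by
  have hL : fderiv 𝕜 (fun z => G (q z)) 0 = (fderiv 𝕜 G 0).comp (fderiv 𝕜 q 0) := by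
    have hGd0 : DifferentiableAt 𝕜 G (q 0) := by rw [hq0]; exact hGd
    rw [show (fun z => G (q z)) = G ∘ q from rfl, fderiv_comp 0 hGd0 hqd, hq0]
  have hR : fderiv 𝕜 (fun z => q (c • z)) 0 = (fderiv 𝕜 q 0).comp (c • ContinuousLinearMap.id 𝕜 W) := by
    have hs : HasFDerivAt (fun z : W => c • z) (c • ContinuousLinearMap.id 𝕜 W) 0 :=
      (hasFDerivAt_id (0 : W)).const_smul c
    have hqd0 : DifferentiableAt 𝕜 q ((fun z : W => c • z) 0) := by
      show DifferentiableAt 𝕜 q (c • 0)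
      rw [smul_zero]; exact hqd
    rw [show (fun z => q (c • z)) = q ∘ (fun z : W => c • z) from rfl, fderiv_comp 0 hqd0 hs.differentiableAt,
      hs.fderiv]
    show (fderiv 𝕜 q (c • 0)).comp _ = _
    rw [smul_zero]
  have hkey : (fderiv 𝕜 G 0).comp (fderiv 𝕜 q 0) = (fderiv 𝕜 q 0).comp (c • ContinuousLinearMap.id 𝕜 W) := by
    rw [← hL, ← hR]
    exact hconj.fderiv_eq
  ext w
  obtain ⟨v, rfl⟩ := hsurj w
  have h := congrArg (fun T : W →L[𝕜] W => T v) hkey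
  simp only [ContinuousLinearMap.comp_apply, smul_apply, ContinuousLinearMap.id_apply,
    ContinuousLinearMap.map_smul] at h
  simp only [smul_apply, ContinuousLinearMap.id_apply]
  exact h

/-! ## §1 The fibre coordinate of an immersed vertical curve has injective (hence onto) differential -/

section FibreCoordinate

variable (χ : OpenPartialHomeomorph M (B × W)) (π : W → M) (u : B)

/-- **The fibre coordinate of a vertical immersion is an immersion.**  If `π : W → M` is differentiable at `0` with
injective differential, `π 0 ∈ χ.source` for a chart `χ : M ⇀ B × W` that is differentiable at `π 0` with
differentiable inverse at `χ (π 0)`, and the first coordinate `(χ (π z)).1` is constant near `z = 0`, then the fibre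
coordinate `q z := (χ (π z)).2 : W → W` has INJECTIVE differential at `0` (the differential of `χ ∘ π` is
`v ↦ (0, Dq v)` and is injective). [cite: Milnor2006, §8 Thm. 8.2] [cite: MumfordAV1970, §4 (iv)] -/
theorem injective_fderiv_snd_comp (hπ0 : π 0 ∈ χ.source) (hfst : ∀ᶠ z in 𝓝 (0 : W), (χ (π z)).1 = u)
    (hπd : MDifferentiableAt 𝓘(𝕜, W) I π 0) (hinj : Injective (mfderiv 𝓘(𝕜, W) I π 0))
    (hχd : MDifferentiableAt I (IB.prod 𝓘(𝕜, W)) χ (π 0))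
    (hχsd : MDifferentiableAt (IB.prod 𝓘(𝕜, W)) I χ.symm (χ (π 0))) :
    Injective (fderiv 𝕜 (fun z : W => (χ (π z)).2) 0) := by
  -- the two components of `χ ∘ π`
  set f₁ : W → B := fun z => (χ (π z)).1 with hf₁
  set q : W → W := fun z => (χ (π z)).2 with hq
  have hχπ : MDifferentiableAt 𝓘(𝕜, W) (IB.prod 𝓘(𝕜, W)) (fun z => χ (π z)) 0 := hχd.comp 0 hπd
  have hf₁d : MDifferentiableAt 𝓘(𝕜, W) IB f₁ 0 := mdifferentiableAt_fst.comp 0 hχπ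
  have hqd : MDifferentiableAt 𝓘(𝕜, W) 𝓘(𝕜, W) q 0 := mdifferentiableAt_snd.comp 0 hχπ
  -- `f₁` is eventually constant, so its differential vanishes
  have hf₁0 : ∀ w : W, mfderiv 𝓘(𝕜, W) IB f₁ 0 w = 0 := by
    have h : f₁ =ᶠ[𝓝 0] fun _ => u := hfst
    have h0 : mfderiv 𝓘(𝕜, W) IB f₁ 0 = 0 := by
      rw [h.mfderiv_eq]
      exact mfderiv_const
    intro w
    rw [h0]
    rfl
  -- the differential of `χ ∘ π` at `0` is `v ↦ (0, Dq v)`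
  have hprod : mfderiv 𝓘(𝕜, W) (IB.prod 𝓘(𝕜, W)) (fun z => χ (π z)) 0 =
      (mfderiv 𝓘(𝕜, W) IB f₁ 0).prod (mfderiv 𝓘(𝕜, W) 𝓘(𝕜, W) q 0) := by
    have h : (fun z => χ (π z)) = fun z => (f₁ z, q z) := rfl
    rw [h]
    exact mfderiv_prodMk hf₁d hqd
  -- `π = χ.symm ∘ (χ ∘ π)` near `0`, so `Dπ (0) = Dχ.symm ∘ D(χ ∘ π) (0)`
  have hleft : π =ᶠ[𝓝 0] fun z => χ.symm (χ (π z)) := by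
    have hsrc : ∀ᶠ z in 𝓝 (0 : W), π z ∈ χ.source :=
      hπd.continuousAt.preimage_mem_nhds (χ.open_source.mem_nhds hπ0)
    filter_upwards [hsrc] with z hz
    exact (χ.left_inv hz).symm
  have hcomp : mfderiv 𝓘(𝕜, W) I π 0 =
      (mfderiv (IB.prod 𝓘(𝕜, W)) I χ.symm (χ (π 0))).comp
        (mfderiv 𝓘(𝕜, W) (IB.prod 𝓘(𝕜, W)) (fun z => χ (π z)) 0) := by
    rw [hleft.mfderiv_eq]
    exact mfderiv_comp 0 hχsd hχπ
  -- pointwise forms (the tangent spaces are the model spaces only up to unfolding `TangentSpace`, so we avoid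
  -- rewriting under coercions and chain equalities with `Eq.trans` ∕ `rfl` instead)
  set T := mfderiv 𝓘(𝕜, W) (IB.prod 𝓘(𝕜, W)) (fun z => χ (π z)) 0 with hT
  have hTw : ∀ w : W, T w = ((0 : EB), mfderiv 𝓘(𝕜, W) 𝓘(𝕜, W) q 0 w) := fun w =>
    (DFunLike.congr_fun hprod w).trans (Prod.ext (hf₁0 w) rfl)
  have hcomp' : ∀ w : W, mfderiv 𝓘(𝕜, W) I π 0 w = mfderiv (IB.prod 𝓘(𝕜, W)) I χ.symm (χ (π 0)) (T w) :=
    fun w => (DFunLike.congr_fun hcomp w).trans rfl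
  -- conclude
  intro v v' hvv'
  have e : mfderiv 𝓘(𝕜, W) 𝓘(𝕜, W) q 0 = fderiv 𝕜 q 0 := mfderiv_eq_fderiv
  have hvv'' : mfderiv 𝓘(𝕜, W) 𝓘(𝕜, W) q 0 v = mfderiv 𝓘(𝕜, W) 𝓘(𝕜, W) q 0 v' :=
    ((DFunLike.congr_fun e v).trans hvv').trans (DFunLike.congr_fun e v').symm
  have hTv : T v = T v' :=
    (hTw v).trans ((congrArg (fun x => ((0 : EB), x)) hvv'').trans (hTw v').symm)
  apply hinj
  exact (hcomp' v).trans ((congrArg (mfderiv (IB.prod 𝓘(𝕜, W)) I χ.symm (χ (π 0))) hTv).trans (hcomp' v').symm)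

/-- In finite dimension the fibre coordinate `q z := (χ (π z)).2` of a vertical immersion (as in
`injective_fderiv_snd_comp`) has ONTO differential at `0`. [cite: Milnor2006, §8 Thm. 8.2] [cite: MumfordAV1970, §4 (iv)] -/
theorem surjective_fderiv_snd_comp [FiniteDimensional 𝕜 W] (hπ0 : π 0 ∈ χ.source)
    (hfst : ∀ᶠ z in 𝓝 (0 : W), (χ (π z)).1 = u)
    (hπd : MDifferentiableAt 𝓘(𝕜, W) I π 0) (hinj : Injective (mfderiv 𝓘(𝕜, W) I π 0))
    (hχd : MDifferentiableAt I (IB.prod 𝓘(𝕜, W)) χ (π 0))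
    (hχsd : MDifferentiableAt (IB.prod 𝓘(𝕜, W)) I χ.symm (χ (π 0))) :
    Surjective (fderiv 𝕜 (fun z : W => (χ (π z)).2) 0) := by
  have hinjq := injective_fderiv_snd_comp χ π u hπ0 hfst hπd hinj hχd hχsd
  exact (LinearMap.injective_iff_surjective
    (f := ((fderiv 𝕜 (fun z : W => (χ (π z)).2) 0 : W →L[𝕜] W) : W →ₗ[𝕜] W))).1 hinjq

end FibreCoordinate

/-! ## §2 The vertical multiplier of an equivariant self-map is the scalar (product-model target `B × W`) -/

section Multiplier

variable (χ : OpenPartialHomeomorph M (B × W)) (two : M → M) (π : W → M) (u : B) (c : 𝕜)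

/-- The fibre coordinate `G_b : w ↦ (χ (two (χ.symm (b, w)))).2` of `two` FIXES `0` over every point `b` whose
zero `χ.symm (b, 0)` is a fixed point of `two` lying in the chart (e.g. along a `two`-fixed zero section straightened
to `{w = 0}` by `χ`). [cite: Milnor2006, §8 Thm. 8.2] -/
theorem snd_conj_zero_of_fixed {z₀ : M} {b : B} (hz₀ : z₀ ∈ χ.source) (hχz₀ : χ z₀ = (b, 0))
    (hfix : two z₀ = z₀) : (χ (two (χ.symm (b, 0)))).2 = 0 := by
  rw [← hχz₀, χ.left_inv hz₀, hfix, hχz₀]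

/-- The fibre coordinate `G_u : w ↦ (χ (two (χ.symm (u, w)))).2` of `two` is DIFFERENTIABLE at `0` when `χ.symm` is
differentiable at `(u, 0) = χ z₀`, `two` at `z₀ = χ.symm (u, 0)` and `χ` at `two z₀ = z₀`. [cite: Milnor2006, §8 Thm. 8.2] -/
theorem differentiableAt_snd_conj {z₀ : M} (hz₀ : z₀ ∈ χ.source) (hχz₀ : χ z₀ = (u, 0)) (hfix : two z₀ = z₀)
    (htwo : MDifferentiableAt I I two z₀) (hχd : MDifferentiableAt I (IB.prod 𝓘(𝕜, W)) χ z₀)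
    (hχsd : MDifferentiableAt (IB.prod 𝓘(𝕜, W)) I χ.symm (u, 0)) :
    DifferentiableAt 𝕜 (fun w : W => (χ (two (χ.symm (u, w)))).2) 0 := by
  have hsymm0 : χ.symm (u, 0) = z₀ := by rw [← hχz₀, χ.left_inv hz₀]
  have h1 : MDifferentiableAt 𝓘(𝕜, W) (IB.prod 𝓘(𝕜, W)) (fun w : W => ((u, w) : B × W)) 0 :=
    mdifferentiableAt_const.prodMk mdifferentiableAt_id
  have h2 : MDifferentiableAt 𝓘(𝕜, W) I (fun w : W => χ.symm (u, w)) 0 := hχsd.comp 0 h1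
  have h3 : MDifferentiableAt 𝓘(𝕜, W) I (fun w : W => two (χ.symm (u, w))) 0 := by
    have htwo' : MDifferentiableAt I I two ((fun w : W => χ.symm (u, w)) 0) := by
      show MDifferentiableAt I I two (χ.symm (u, 0))
      rw [hsymm0]; exact htwo
    exact htwo'.comp 0 h2
  have h4 : MDifferentiableAt 𝓘(𝕜, W) (IB.prod 𝓘(𝕜, W)) (fun w : W => χ (two (χ.symm (u, w)))) 0 := by
    have hχd' : MDifferentiableAt I (IB.prod 𝓘(𝕜, W)) χ ((fun w : W => two (χ.symm (u, w))) 0) := by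
      show MDifferentiableAt I (IB.prod 𝓘(𝕜, W)) χ (two (χ.symm (u, 0)))
      rw [hsymm0, hfix]; exact hχd
    exact hχd'.comp 0 h3
  exact (mdifferentiableAt_snd.comp 0 h4).differentiableAt

/-- **THE VERTICAL MULTIPLIER OF AN EQUIVARIANT SELF-MAP** (main theorem).  Let `χ : M ⇀ B × W` be a chart (`W`
finite-dimensional), differentiable at `π 0 ∈ χ.source` with differentiable inverse at `χ (π 0) = (u, 0)`; let
`two : M → M` be differentiable at `π 0`; let `π : W → M` be differentiable at `0` with INJECTIVE differential, with
first coordinate `(χ (π z)).1 = u` constant near `0`, and EQUIVARIANT: `two (π z) = π (c • z)` near `0`.  Then the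
fibre coordinate `G_u w := (χ (two (χ.symm (u, w)))).2` of `two` has derivative EXACTLY `c • id` at `0`:
`fderiv 𝕜 G_u 0 = c • ContinuousLinearMap.id 𝕜 W`.  (Germ identity `G_u ∘ q = q ∘ (c •)` for `q z = (χ (π z)).2`,
chain rule, and `Dq (0)` onto by §1.)  This is the shape of the hypothesis `hGd` of the tree's Koenigs linearisation
with parameters. [cite: Milnor2006, §8 Thm. 8.2] [cite: MumfordAV1970, §4 (iv)] -/
theorem fderiv_snd_conj_eq_smul [FiniteDimensional 𝕜 W] (hπ0 : π 0 ∈ χ.source) (hχπ0 : χ (π 0) = (u, 0))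
    (hfst : ∀ᶠ z in 𝓝 (0 : W), (χ (π z)).1 = u) (h2π : ∀ᶠ z in 𝓝 (0 : W), two (π z) = π (c • z))
    (hπd : MDifferentiableAt 𝓘(𝕜, W) I π 0) (hinj : Injective (mfderiv 𝓘(𝕜, W) I π 0))
    (htwo : MDifferentiableAt I I two (π 0))
    (hχd : MDifferentiableAt I (IB.prod 𝓘(𝕜, W)) χ (π 0))
    (hχsd : MDifferentiableAt (IB.prod 𝓘(𝕜, W)) I χ.symm (u, 0)) :
    fderiv 𝕜 (fun w : W => (χ (two (χ.symm (u, w)))).2) 0 = c • ContinuousLinearMap.id 𝕜 W := by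
  set q : W → W := fun z => (χ (π z)).2 with hq
  have hχsd' : MDifferentiableAt (IB.prod 𝓘(𝕜, W)) I χ.symm (χ (π 0)) := by
    rw [hχπ0]; exact hχsd
  have htwo0 : two (π 0) = π 0 := by
    have h := h2π.self_of_nhds
    rwa [smul_zero] at h
  -- the germ identity `G ∘ q = q ∘ (c • ·)` at `0`
  have hsrc : ∀ᶠ z in 𝓝 (0 : W), π z ∈ χ.source :=
    hπd.continuousAt.preimage_mem_nhds (χ.open_source.mem_nhds hπ0)
  have hconj : (fun z => (χ (two (χ.symm (u, q z)))).2) =ᶠ[𝓝 0] fun z => q (c • z) := by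
    filter_upwards [hsrc, hfst, h2π] with z hz h1 h2
    have hχπz : χ (π z) = ((u, (χ (π z)).2) : B × W) := Prod.ext h1 rfl
    show (χ (two (χ.symm (u, (χ (π z)).2)))).2 = (χ (π (c • z))).2
    rw [← hχπz, χ.left_inv hz, h2]
  -- calculus (§0) with `Dq (0)` onto (§1)
  have hq0 : q 0 = 0 := by
    show (χ (π 0)).2 = 0
    rw [hχπ0]
  exact fderiv_eq_smul_of_conj hq0 (mdifferentiableAt_snd.comp 0 (hχd.comp 0 hπd)).differentiableAt
    (differentiableAt_snd_conj χ two u hπ0 hχπ0 htwo0 htwo hχd hχsd)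
    (surjective_fderiv_snd_comp χ π u hπ0 hfst hπd hinj hχd hχsd') hconj

/-- **Global-hypotheses form over a base map** (the shape met by a tubular chart adapted to a projection `p : M → B`:
first coordinate `= p` on the source, and a curve `π` inside the fibre `p ⁻¹ {u}`, equivariant everywhere): the fibre
coordinate of `two` at `u` has derivative `c • id` at `0`. [cite: Milnor2006, §8 Thm. 8.2] [cite: MumfordAV1970, §4 (iv)] -/
theorem fderiv_snd_conj_eq_smul_of_proj [FiniteDimensional 𝕜 W] (p : M → B)
    (hχ1 : ∀ a ∈ χ.source, (χ a).1 = p a) (hπ0 : π 0 ∈ χ.source) (hχπ0 : χ (π 0) = (u, 0))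
    (hpπ : ∀ z : W, p (π z) = u) (h2π : ∀ z : W, two (π z) = π (c • z))
    (hπd : MDifferentiableAt 𝓘(𝕜, W) I π 0) (hinj : Injective (mfderiv 𝓘(𝕜, W) I π 0))
    (htwo : MDifferentiableAt I I two (π 0))
    (hχd : MDifferentiableAt I (IB.prod 𝓘(𝕜, W)) χ (π 0))
    (hχsd : MDifferentiableAt (IB.prod 𝓘(𝕜, W)) I χ.symm (u, 0)) :
    fderiv 𝕜 (fun w : W => (χ (two (χ.symm (u, w)))).2) 0 = c • ContinuousLinearMap.id 𝕜 W := by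
  have hsrc : ∀ᶠ z in 𝓝 (0 : W), π z ∈ χ.source :=
    hπd.continuousAt.preimage_mem_nhds (χ.open_source.mem_nhds hπ0)
  have hfst : ∀ᶠ z in 𝓝 (0 : W), (χ (π z)).1 = u := by
    filter_upwards [hsrc] with z hz
    rw [hχ1 _ hz, hpπ]
  exact fderiv_snd_conj_eq_smul χ two π u c hπ0 hχπ0 hfst (Eventually.of_forall h2π) hπd hinj htwo hχd hχsd

end Multiplier

/-! ## §3 The same for a chart valued in a normed product `P × W` read with the self model `𝓘(𝕜, P × W)` -/

namespace SelfModel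

variable {P : Type*} [NormedAddCommGroup P] [NormedSpace 𝕜 P]
  (χ : OpenPartialHomeomorph M (P × W)) (two : M → M) (π : W → M) (u : P) (c : 𝕜)

/-- §1 for a chart `χ : M ⇀ P × W` into a normed product read with `𝓘(𝕜, P × W)`: the fibre coordinate
`q z := (χ (π z)).2` of a vertical immersion `π` has INJECTIVE differential at `0`.
[cite: Milnor2006, §8 Thm. 8.2] [cite: MumfordAV1970, §4 (iv)] -/
theorem injective_fderiv_snd_comp (hπ0 : π 0 ∈ χ.source) (hfst : ∀ᶠ z in 𝓝 (0 : W), (χ (π z)).1 = u)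
    (hπd : MDifferentiableAt 𝓘(𝕜, W) I π 0) (hinj : Injective (mfderiv 𝓘(𝕜, W) I π 0))
    (hχd : MDifferentiableAt I 𝓘(𝕜, P × W) χ (π 0))
    (hχsd : MDifferentiableAt 𝓘(𝕜, P × W) I χ.symm (χ (π 0))) :
    Injective (fderiv 𝕜 (fun z : W => (χ (π z)).2) 0) := by
  set f₁ : W → P := fun z => (χ (π z)).1 with hf₁
  set q : W → W := fun z => (χ (π z)).2 with hq
  have hχπ : MDifferentiableAt 𝓘(𝕜, W) 𝓘(𝕜, P × W) (fun z => χ (π z)) 0 := hχd.comp 0 hπd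
  have hχπd : DifferentiableAt 𝕜 (fun z => χ (π z)) 0 := hχπ.differentiableAt
  -- `f₁` is eventually constant, so its differential vanishes; `D(χ ∘ π) (0) = (0, Dq)`
  have hf₁0 : fderiv 𝕜 f₁ 0 = 0 := by
    have h : f₁ =ᶠ[𝓝 0] fun _ => u := hfst
    rw [h.fderiv_eq, fderiv_const_apply]
  have hprod : fderiv 𝕜 (fun z => χ (π z)) 0 = (fderiv 𝕜 f₁ 0).prod (fderiv 𝕜 q 0) :=
    hχπd.fst.fderiv_prodMk hχπd.snd
  have hT : mfderiv 𝓘(𝕜, W) 𝓘(𝕜, P × W) (fun z => χ (π z)) 0 = fderiv 𝕜 (fun z => χ (π z)) 0 :=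
    mfderiv_eq_fderiv
  have hTw : ∀ w : W, mfderiv 𝓘(𝕜, W) 𝓘(𝕜, P × W) (fun z => χ (π z)) 0 w = ((0 : P), fderiv 𝕜 q 0 w) :=
    fun w => (DFunLike.congr_fun hT w).trans
      ((DFunLike.congr_fun hprod w).trans (Prod.ext (DFunLike.congr_fun hf₁0 w) rfl))
  -- `π = χ.symm ∘ (χ ∘ π)` near `0`
  have hleft : π =ᶠ[𝓝 0] fun z => χ.symm (χ (π z)) := by
    have hsrc : ∀ᶠ z in 𝓝 (0 : W), π z ∈ χ.source :=
      hπd.continuousAt.preimage_mem_nhds (χ.open_source.mem_nhds hπ0)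
    filter_upwards [hsrc] with z hz
    exact (χ.left_inv hz).symm
  have hcomp : mfderiv 𝓘(𝕜, W) I π 0 =
      (mfderiv 𝓘(𝕜, P × W) I χ.symm (χ (π 0))).comp (mfderiv 𝓘(𝕜, W) 𝓘(𝕜, P × W) (fun z => χ (π z)) 0) := by
    rw [hleft.mfderiv_eq]
    exact mfderiv_comp 0 hχsd hχπ
  have hcomp' : ∀ w : W, mfderiv 𝓘(𝕜, W) I π 0 w =
      mfderiv 𝓘(𝕜, P × W) I χ.symm (χ (π 0)) (mfderiv 𝓘(𝕜, W) 𝓘(𝕜, P × W) (fun z => χ (π z)) 0 w) :=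
    fun w => (DFunLike.congr_fun hcomp w).trans rfl
  -- conclude
  intro v v' hvv'
  have hTv : mfderiv 𝓘(𝕜, W) 𝓘(𝕜, P × W) (fun z => χ (π z)) 0 v =
      mfderiv 𝓘(𝕜, W) 𝓘(𝕜, P × W) (fun z => χ (π z)) 0 v' :=
    (hTw v).trans ((congrArg (fun x => ((0 : P), x)) hvv').trans (hTw v').symm)
  apply hinj
  exact (hcomp' v).trans ((congrArg (mfderiv 𝓘(𝕜, P × W) I χ.symm (χ (π 0))) hTv).trans (hcomp' v').symm)

/-- §1 in finite dimension, self-model target: the fibre coordinate of a vertical immersion has ONTO differential at `0`.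
[cite: Milnor2006, §8 Thm. 8.2] [cite: MumfordAV1970, §4 (iv)] -/
theorem surjective_fderiv_snd_comp [FiniteDimensional 𝕜 W] (hπ0 : π 0 ∈ χ.source)
    (hfst : ∀ᶠ z in 𝓝 (0 : W), (χ (π z)).1 = u)
    (hπd : MDifferentiableAt 𝓘(𝕜, W) I π 0) (hinj : Injective (mfderiv 𝓘(𝕜, W) I π 0))
    (hχd : MDifferentiableAt I 𝓘(𝕜, P × W) χ (π 0))
    (hχsd : MDifferentiableAt 𝓘(𝕜, P × W) I χ.symm (χ (π 0))) :
    Surjective (fderiv 𝕜 (fun z : W => (χ (π z)).2) 0) := by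
  have hinjq := injective_fderiv_snd_comp χ π u hπ0 hfst hπd hinj hχd hχsd
  exact (LinearMap.injective_iff_surjective
    (f := ((fderiv 𝕜 (fun z : W => (χ (π z)).2) 0 : W →L[𝕜] W) : W →ₗ[𝕜] W))).1 hinjq

/-- Self-model target: the fibre coordinate `G_u` of `two` is differentiable at `0` (`χ.symm` differentiable at
`(u, 0) = χ z₀`, `two` at the fixed point `z₀`, `χ` at `z₀`). [cite: Milnor2006, §8 Thm. 8.2] -/
theorem differentiableAt_snd_conj {z₀ : M} (hz₀ : z₀ ∈ χ.source) (hχz₀ : χ z₀ = (u, 0)) (hfix : two z₀ = z₀)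
    (htwo : MDifferentiableAt I I two z₀) (hχd : MDifferentiableAt I 𝓘(𝕜, P × W) χ z₀)
    (hχsd : MDifferentiableAt 𝓘(𝕜, P × W) I χ.symm (u, 0)) :
    DifferentiableAt 𝕜 (fun w : W => (χ (two (χ.symm (u, w)))).2) 0 := by
  have hsymm0 : χ.symm (u, 0) = z₀ := by rw [← hχz₀, χ.left_inv hz₀]
  have h1' : DifferentiableAt 𝕜 (fun w : W => ((u, w) : P × W)) 0 :=
    (differentiableAt_const u).prodMk differentiableAt_id
  have h1 : MDifferentiableAt 𝓘(𝕜, W) 𝓘(𝕜, P × W) (fun w : W => ((u, w) : P × W)) 0 := h1'.mdifferentiableAt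
  have h2 : MDifferentiableAt 𝓘(𝕜, W) I (fun w : W => χ.symm (u, w)) 0 := hχsd.comp 0 h1
  have h3 : MDifferentiableAt 𝓘(𝕜, W) I (fun w : W => two (χ.symm (u, w))) 0 := by
    have htwo' : MDifferentiableAt I I two ((fun w : W => χ.symm (u, w)) 0) := by
      show MDifferentiableAt I I two (χ.symm (u, 0))
      rw [hsymm0]; exact htwo
    exact htwo'.comp 0 h2
  have h4 : MDifferentiableAt 𝓘(𝕜, W) 𝓘(𝕜, P × W) (fun w : W => χ (two (χ.symm (u, w)))) 0 := by
    have hχd' : MDifferentiableAt I 𝓘(𝕜, P × W) χ ((fun w : W => two (χ.symm (u, w))) 0) := by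
      show MDifferentiableAt I 𝓘(𝕜, P × W) χ (two (χ.symm (u, 0)))
      rw [hsymm0, hfix]; exact hχd
    exact hχd'.comp 0 h3
  exact h4.differentiableAt.snd

/-- **THE VERTICAL MULTIPLIER OF AN EQUIVARIANT SELF-MAP, self-model target** (`χ : M ⇀ P × W` read with
`𝓘(𝕜, P × W)`; hypotheses and conclusion otherwise as in `ConjugacyVerticalMultiplier.fderiv_snd_conj_eq_smul`):
`fderiv 𝕜 (fun w ↦ (χ (two (χ.symm (u, w)))).2) 0 = c • ContinuousLinearMap.id 𝕜 W`.
[cite: Milnor2006, §8 Thm. 8.2] [cite: MumfordAV1970, §4 (iv)] -/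
theorem fderiv_snd_conj_eq_smul [FiniteDimensional 𝕜 W] (hπ0 : π 0 ∈ χ.source) (hχπ0 : χ (π 0) = (u, 0))
    (hfst : ∀ᶠ z in 𝓝 (0 : W), (χ (π z)).1 = u) (h2π : ∀ᶠ z in 𝓝 (0 : W), two (π z) = π (c • z))
    (hπd : MDifferentiableAt 𝓘(𝕜, W) I π 0) (hinj : Injective (mfderiv 𝓘(𝕜, W) I π 0))
    (htwo : MDifferentiableAt I I two (π 0))
    (hχd : MDifferentiableAt I 𝓘(𝕜, P × W) χ (π 0))
    (hχsd : MDifferentiableAt 𝓘(𝕜, P × W) I χ.symm (u, 0)) :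
    fderiv 𝕜 (fun w : W => (χ (two (χ.symm (u, w)))).2) 0 = c • ContinuousLinearMap.id 𝕜 W := by
  set q : W → W := fun z => (χ (π z)).2 with hq
  have hχsd' : MDifferentiableAt 𝓘(𝕜, P × W) I χ.symm (χ (π 0)) := by
    rw [hχπ0]; exact hχsd
  have htwo0 : two (π 0) = π 0 := by
    have h := h2π.self_of_nhds
    rwa [smul_zero] at h
  have hsrc : ∀ᶠ z in 𝓝 (0 : W), π z ∈ χ.source :=
    hπd.continuousAt.preimage_mem_nhds (χ.open_source.mem_nhds hπ0)
  have hconj : (fun z => (χ (two (χ.symm (u, q z)))).2) =ᶠ[𝓝 0] fun z => q (c • z) := by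
    filter_upwards [hsrc, hfst, h2π] with z hz h1 h2
    have hχπz : χ (π z) = ((u, (χ (π z)).2) : P × W) := Prod.ext h1 rfl
    show (χ (two (χ.symm (u, (χ (π z)).2)))).2 = (χ (π (c • z))).2
    rw [← hχπz, χ.left_inv hz, h2]
  have hq0 : q 0 = 0 := by
    show (χ (π 0)).2 = 0
    rw [hχπ0]
  exact fderiv_eq_smul_of_conj hq0 (hχd.comp 0 hπd).differentiableAt.snd
    (differentiableAt_snd_conj χ two u hπ0 hχπ0 htwo0 htwo hχd hχsd)
    (surjective_fderiv_snd_comp χ π u hπ0 hfst hπd hinj hχd hχsd') hconj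

/-- Self-model target, global hypotheses over a base map `p : M → P` (first coordinate of the chart `= p`, the curve
`π` inside `p ⁻¹ {u}`, equivariant everywhere) — the shape produced by a tubular chart `κ : MA ⇀ ES × F` whose first
coordinate is a chart of the base composed with the projection. [cite: Milnor2006, §8 Thm. 8.2] [cite: MumfordAV1970, §4 (iv)] -/
theorem fderiv_snd_conj_eq_smul_of_proj [FiniteDimensional 𝕜 W] (p : M → P)
    (hχ1 : ∀ a ∈ χ.source, (χ a).1 = p a) (hπ0 : π 0 ∈ χ.source) (hχπ0 : χ (π 0) = (u, 0))
    (hpπ : ∀ z : W, p (π z) = u) (h2π : ∀ z : W, two (π z) = π (c • z))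
    (hπd : MDifferentiableAt 𝓘(𝕜, W) I π 0) (hinj : Injective (mfderiv 𝓘(𝕜, W) I π 0))
    (htwo : MDifferentiableAt I I two (π 0))
    (hχd : MDifferentiableAt I 𝓘(𝕜, P × W) χ (π 0))
    (hχsd : MDifferentiableAt 𝓘(𝕜, P × W) I χ.symm (u, 0)) :
    fderiv 𝕜 (fun w : W => (χ (two (χ.symm (u, w)))).2) 0 = c • ContinuousLinearMap.id 𝕜 W := by
  have hsrc : ∀ᶠ z in 𝓝 (0 : W), π z ∈ χ.source :=
    hπd.continuousAt.preimage_mem_nhds (χ.open_source.mem_nhds hπ0)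
  have hfst : ∀ᶠ z in 𝓝 (0 : W), (χ (π z)).1 = u := by
    filter_upwards [hsrc] with z hz
    rw [hχ1 _ hz, hpπ]
  exact fderiv_snd_conj_eq_smul χ two π u c hπ0 hχπ0 hfst (Eventually.of_forall h2π) hπd hinj htwo hχd hχsd

end SelfModel

end Literature.Geometry.Manifold.ConjugacyVerticalMultiplier
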